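import Mathlib.Analysis.Normed.Operator.BanachSteinhaus
import Mathlib.Topology.ContinuousMap.Bounded.Normed
import Summits.QuantumFields.YangMills.Theorems.BalabanUVNodesN19LacunaryCosineSums

/-!
# N19 (NE7, s3 ALTERNATIVE CURRENCY) — Riesz products and the lacunary cosine-coefficient functionals

Module 94 of the `dag-n19-e` lineage (uniform-moment currency, fixed observables; CURRENCY-MAP v3 item
(w′)): the analytic engine of the NEGATIVE answer to (w′).  For a bounded continuous `f : ℝ → ℝ` put
`c_ν(f) = ∫_0^π f(φ)cos(νφ)dφ`; along the lacunary frequencies `ν_k = 4^{k+1} + 1` the DIFFERENCES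
`d_k(f) = c_{ν_k}(f) − c_{ν_k+2}(f)` are exactly what the arcsine road (module 95) pays the observable
`x ↦ ∫_0^x f(arccos 2y)dy`.  They are NOT absolutely summable for some bounded continuous `f`
(★★ `exists_bcf_lacunaryCoeffDiff_not_summable`; normalised plain-function form
★★ `exists_continuous_lacunaryCoeffDiff_not_summable`):

* §1 the RIESZ PRODUCTS `R_M(φ) = ∏_{k<M}(1 + i·a·cos(ν_kφ))`: `‖R_M‖ ≤ √((1+a²)^M)`, `≤ e^{1∕2}` at
  `a = 1∕√M`; `Im R_M = Σ_{S⊆[M]} Im((ia)^{|S|})·∏_{k∈S}cos(ν_kφ)`, so by module 93 (non-resonant products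
  integrate to zero; dissociativity of `ν_k`) `c_{ν_j}(Im R_M) = aπ∕2` (`j < M`) and `c_{ν_j+2}(Im R_M) = 0`;
* §2 the functionals `ℓ_M = Σ_{k<M} d_k` are continuous linear on the Banach space `ℝ →ᵇ ℝ`, with
  `ℓ_M(Im R_M) = (π∕2)√M` although `‖Im R_M‖ ≤ e^{1∕2}`; so `‖ℓ_M‖ → ∞`, and the uniform boundedness
  principle (Mathlib `banach_steinhaus`) yields an `f` at which `ℓ_M(f)` is unbounded — in particular
  `Σ_k |d_k(f)| = ∞`.  (This is the `√log`-growth of CURRENCY-MAP v3's heuristic: `M` levels reach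
  frequency `4^M`.)

HONEST FRAMING: [folklore] harmonic analysis (Riesz products, Zygmund *Trigonometric Series* V.7; the
uniform boundedness principle) over Mathlib and module 93 BY NAME; the bad function is NON-CONSTRUCTIVE
(Baire category); no consumer in the DAG today; nothing of Bałaban's is instantiated; NE7 is NOT PRINTED
and NOT proved here; N19 is NOT discharged; count-neutral.  One finite 𝕋⁴ programme at fixed ε; nothing
continuum ∕ OS ∕ mass-gap ∕ Clay.
-/

open Real Finset MeasureTheory BoundedContinuousFunction

namespace Summit.QuantumFields.YangMills.Theorems.BalabanUVNodesN19RieszProductCosineFunctionals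

open BalabanUVNodesN19LacunaryCosineSums

/-! ## §1 Riesz products [folklore] -/

/-- `‖1 + i·t‖² = 1 + t²`. [bookkeeping] -/
theorem norm_one_add_I_mul_sq (t : ℝ) : ‖(1 : ℂ) + Complex.I * t‖ ^ 2 = 1 + t ^ 2 := by
  rw [Complex.sq_norm, Complex.normSq_apply]
  simp; ring

/-- `‖∏_{k<M}(1 + i·a·c_k)‖ ≤ √((1+a²)^M)` for real `|c_k| ≤ 1`. [folklore] -/
theorem norm_rieszProd_le {M : ℕ} {a : ℝ} {c : ℕ → ℝ} (hc : ∀ k, |c k| ≤ 1) :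
    ‖∏ k ∈ range M, ((1 : ℂ) + (Complex.I * a) * (c k : ℂ))‖ ≤ Real.sqrt ((1 + a ^ 2) ^ M) := by
  rw [Real.le_sqrt (norm_nonneg _) (by positivity), norm_prod, ← Finset.prod_pow]
  calc ∏ k ∈ range M, ‖(1 : ℂ) + Complex.I * a * (c k : ℂ)‖ ^ 2
      = ∏ k ∈ range M, (1 + (a * c k) ^ 2) := by
        refine Finset.prod_congr rfl fun k _ => ?_
        rw [mul_assoc, ← Complex.ofReal_mul, norm_one_add_I_mul_sq]
    _ ≤ ∏ _k ∈ range M, (1 + a ^ 2) := by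
        refine Finset.prod_le_prod (fun _ _ => by positivity) fun k _ => ?_
        have h1 : (c k) ^ 2 ≤ 1 := (sq_le_one_iff_abs_le_one _).2 (hc k)
        nlinarith [sq_nonneg a]
    _ = (1 + a ^ 2) ^ M := by rw [Finset.prod_const, Finset.card_range]

/-- At `a = 1∕√M` (`M ≥ 1`): `‖∏_{k<M}(1 + i·a·c_k)‖ ≤ e^{1∕2}`, from `(1 + 1∕M)^M ≤ e`. [folklore] -/
theorem norm_rieszProd_le_exp_half {M : ℕ} (hM : 1 ≤ M) {c : ℕ → ℝ} (hc : ∀ k, |c k| ≤ 1) :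
    ‖∏ k ∈ range M, ((1 : ℂ) + (Complex.I * (Real.sqrt M)⁻¹) * (c k : ℂ))‖ ≤ Real.exp (1 / 2) := by
  refine (norm_rieszProd_le hc).trans ?_
  have hMpos : (0 : ℝ) < M := by exact_mod_cast hM
  have ha : ((Real.sqrt M)⁻¹) ^ 2 = 1 / M := by
    rw [inv_pow, Real.sq_sqrt hMpos.le, one_div]
  rw [ha, show (1 : ℝ) / 2 = 1 / 2 from rfl, Real.exp_half]
  refine Real.sqrt_le_sqrt ?_
  have h1 : (1 : ℝ) + 1 / M ≤ Real.exp (1 / M) := by linarith [Real.add_one_le_exp (1 / M : ℝ)]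
  calc (1 + 1 / (M : ℝ)) ^ M ≤ (Real.exp (1 / M)) ^ M := pow_le_pow_left₀ (by positivity) h1 M
    _ = Real.exp 1 := by rw [← Real.exp_nat_mul]; congr 1; field_simp

/-- Expansion of the Riesz product over subsets. [bookkeeping] -/
theorem rieszProd_eq_sum (M : ℕ) (a : ℝ) (c : ℕ → ℝ) :
    ∏ k ∈ range M, ((1 : ℂ) + (Complex.I * a) * (c k : ℂ)) =
      ∑ S ∈ (range M).powerset, (Complex.I * a) ^ S.card * ((∏ k ∈ S, c k : ℝ) : ℂ) := by
  rw [Finset.prod_one_add]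
  refine Finset.sum_congr rfl fun S _ => ?_
  rw [Finset.prod_mul_distrib, Finset.prod_const, Complex.ofReal_prod]

/-- Imaginary part of the Riesz product: a real combination of products of the `c_k`, the
coefficient of `∏_{k∈S}c_k` depending on `|S|` only. [bookkeeping] -/
theorem im_rieszProd_eq_sum (M : ℕ) (a : ℝ) (c : ℕ → ℝ) :
    (∏ k ∈ range M, ((1 : ℂ) + (Complex.I * a) * (c k : ℂ))).im =
      ∑ S ∈ (range M).powerset, ((Complex.I * a) ^ S.card).im * ∏ k ∈ S, c k := by
  rw [rieszProd_eq_sum, Complex.im_sum]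
  refine Finset.sum_congr rfl fun S _ => ?_
  rw [Complex.mul_im, Complex.ofReal_re, Complex.ofReal_im, mul_zero, zero_add]

/-- Continuity of the imaginary part of the Riesz product at the lacunary frequencies. [bookkeeping] -/
theorem continuous_im_rieszProd (M : ℕ) (a : ℝ) :
    Continuous fun φ : ℝ =>
      (∏ k ∈ range M, ((1 : ℂ) + (Complex.I * a) * (Real.cos (((4 : ℝ) ^ (k + 1) + 1) * φ) : ℂ))).im :=
  Complex.continuous_im.comp (continuous_finsetProd _ fun _ _ => continuous_const.add
    (continuous_const.mul (Complex.continuous_ofReal.comp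
      (Real.continuous_cos.comp (continuous_const.mul continuous_id)))))

/-- Sup bound for the imaginary part at `a = 1∕√M`: `|Im R_M(φ)| ≤ e^{1∕2}`. [folklore] -/
theorem abs_im_rieszProd_le {M : ℕ} (hM : 1 ≤ M) (φ : ℝ) :
    |(∏ k ∈ range M, ((1 : ℂ) + (Complex.I * (Real.sqrt M)⁻¹) *
        (Real.cos (((4 : ℝ) ^ (k + 1) + 1) * φ) : ℂ))).im| ≤ Real.exp (1 / 2) :=
  (Complex.abs_im_le_norm _).trans
    (norm_rieszProd_le_exp_half hM (c := fun k => Real.cos (((4 : ℝ) ^ (k + 1) + 1) * φ))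
      fun _ => Real.abs_cos_le_one _)

/-- The cosine coefficients of `Im R_M` reduce to the product integrals of module 93. [bookkeeping] -/
theorem cosCoeff_im_rieszProd (M : ℕ) (a : ℝ) (ν : ℤ) :
    ∫ φ in (0 : ℝ)..π, (∏ k ∈ range M, ((1 : ℂ) + (Complex.I * a) *
        (Real.cos (((4 : ℝ) ^ (k + 1) + 1) * φ) : ℂ))).im * Real.cos (ν * φ) =
      ∑ S ∈ (range M).powerset, ((Complex.I * a) ^ S.card).im *
        ∫ φ in (0 : ℝ)..π, (∏ k ∈ S, Real.cos ((((4 : ℤ) ^ (k + 1) + 1 : ℤ) : ℝ) * φ)) * Real.cos (ν * φ) := by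
  have hcast : ∀ k : ℕ, ((((4 : ℤ) ^ (k + 1) + 1 : ℤ) : ℝ)) = (4 : ℝ) ^ (k + 1) + 1 := fun k => by push_cast; ring
  simp_rw [hcast]
  have hpt : ∀ φ : ℝ, (∏ k ∈ range M, ((1 : ℂ) + (Complex.I * a) *
        (Real.cos (((4 : ℝ) ^ (k + 1) + 1) * φ) : ℂ))).im * Real.cos (ν * φ) =
      ∑ S ∈ (range M).powerset, ((Complex.I * a) ^ S.card).im *
        ((∏ k ∈ S, Real.cos (((4 : ℝ) ^ (k + 1) + 1) * φ)) * Real.cos (ν * φ)) := by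
    intro φ
    rw [im_rieszProd_eq_sum M a (fun k => Real.cos (((4 : ℝ) ^ (k + 1) + 1) * φ)), Finset.sum_mul]
    refine Finset.sum_congr rfl fun S _ => ?_
    ring
  simp_rw [hpt]
  have hint : ∀ S ∈ (range M).powerset, IntervalIntegrable (fun φ : ℝ => ((Complex.I * a) ^ S.card).im *
      ((∏ k ∈ S, Real.cos (((4 : ℝ) ^ (k + 1) + 1) * φ)) * Real.cos (ν * φ))) volume 0 π := by
    intro S _
    refine (Continuous.intervalIntegrable ?_ _ _)
    refine continuous_const.mul ((continuous_finsetProd _ fun _ _ => ?_).mul ?_)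
    · exact Real.continuous_cos.comp (continuous_const.mul continuous_id)
    · exact Real.continuous_cos.comp (continuous_const.mul continuous_id)
  rw [intervalIntegral.integral_finsetSum hint]
  refine Finset.sum_congr rfl fun S _ => ?_
  exact intervalIntegral.integral_const_mul _ _

/-- ★ THE LACUNARY COEFFICIENTS OF `Im R_M`: `∫_0^π Im R_M(φ)·cos(ν_jφ)dφ = a·π∕2` for `j < M`
(`ν_j = 4^{j+1}+1`; only the singleton `S = {j}` resonates, module 93). [folklore] -/
theorem cosCoeff_im_rieszProd_lacFreq {M j : ℕ} (hj : j < M) (a : ℝ) :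
    ∫ φ in (0 : ℝ)..π, (∏ k ∈ range M, ((1 : ℂ) + (Complex.I * a) *
        (Real.cos (((4 : ℝ) ^ (k + 1) + 1) * φ) : ℂ))).im * Real.cos (((4 : ℝ) ^ (j + 1) + 1) * φ) =
      a * (π / 2) := by
  classical
  have hν : ((((4 : ℤ) ^ (j + 1) + 1 : ℤ) : ℝ)) = (4 : ℝ) ^ (j + 1) + 1 := by push_cast; ring
  rw [← hν, cosCoeff_im_rieszProd M a ((4 : ℤ) ^ (j + 1) + 1)]
  have hjmem : ({j} : Finset ℕ) ∈ (range M).powerset := by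
    rw [Finset.mem_powerset, Finset.singleton_subset_iff]; exact Finset.mem_range.2 hj
  rw [Finset.sum_eq_single_of_mem _ hjmem]
  · -- the resonant singleton
    have hn : ((4 : ℕ) ^ (j + 1) + 1) ≠ 0 := by positivity
    have h := integral_prod_cos_singleton_mul_cos hn j (fun k => (4 : ℤ) ^ (k + 1) + 1) (by push_cast; ring)
    rw [h, Finset.card_singleton, pow_one]
    simp [Complex.mul_im]
  · -- every other subset is non-resonant
    intro S hS hSj
    rw [integral_prod_cos_mul_cos_eq_zero (fun k => (4 : ℤ) ^ (k + 1) + 1) S _ fun ε hε => ?_, mul_zero]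
    constructor
    · intro h; exact hSj (signedSum_eq_lacFreq S ε hε j (Or.inl h))
    · intro h; exact hSj (signedSum_eq_lacFreq S ε hε j (Or.inr h))

/-- ★ THE SHIFTED COEFFICIENTS OF `Im R_M` VANISH: `∫_0^π Im R_M(φ)·cos((ν_j+2)φ)dφ = 0` for every `j`
(no subset resonates with `4^{j+1}+3`, module 93). [folklore] -/
theorem cosCoeff_im_rieszProd_shifted (M j : ℕ) (a : ℝ) :
    ∫ φ in (0 : ℝ)..π, (∏ k ∈ range M, ((1 : ℂ) + (Complex.I * a) *
        (Real.cos (((4 : ℝ) ^ (k + 1) + 1) * φ) : ℂ))).im * Real.cos (((4 : ℝ) ^ (j + 1) + 3) * φ) = 0 := by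
  classical
  have hν : ((((4 : ℤ) ^ (j + 1) + 3 : ℤ) : ℝ)) = (4 : ℝ) ^ (j + 1) + 3 := by push_cast; ring
  rw [← hν, cosCoeff_im_rieszProd M a ((4 : ℤ) ^ (j + 1) + 3)]
  refine Finset.sum_eq_zero fun S _ => ?_
  rw [integral_prod_cos_mul_cos_eq_zero (fun k => (4 : ℤ) ^ (k + 1) + 1) S _ fun ε hε =>
    signedSum_ne_shifted S ε hε j, mul_zero]

/-! ## §2 The coefficient-difference functionals on `ℝ →ᵇ ℝ` and the uniform boundedness principle -/

/-- The cosine coefficient `f ↦ ∫_0^π f(φ)cos(νφ)dφ` is a continuous linear functional on the Banach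
space of bounded continuous functions. [bookkeeping] -/
theorem exists_cosCoeffCLM (ν : ℝ) :
    ∃ L : (ℝ →ᵇ ℝ) →L[ℝ] ℝ, ∀ f : ℝ →ᵇ ℝ, L f = ∫ φ in (0 : ℝ)..π, f φ * Real.cos (ν * φ) := by
  have hint : ∀ f : ℝ →ᵇ ℝ, IntervalIntegrable (fun φ => f φ * Real.cos (ν * φ)) volume 0 π := fun f =>
    (f.continuous.mul (Real.continuous_cos.comp (continuous_const.mul continuous_id))).intervalIntegrable _ _
  refine ⟨LinearMap.mkContinuous
    { toFun := fun f => ∫ φ in (0 : ℝ)..π, f φ * Real.cos (ν * φ)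
      map_add' := fun f g => by
        simp only [BoundedContinuousFunction.coe_add, Pi.add_apply, add_mul]
        exact intervalIntegral.integral_add (hint f) (hint g)
      map_smul' := fun c f => by
        simp only [BoundedContinuousFunction.coe_smul, smul_eq_mul, RingHom.id_apply, mul_assoc]
        exact intervalIntegral.integral_const_mul _ _ } π fun f => ?_, fun f => rfl⟩
  simp only [LinearMap.coe_mk, AddHom.coe_mk]
  have h := intervalIntegral.norm_integral_le_of_norm_le_const (a := 0) (b := π) (C := ‖f‖)
    (f := fun φ => f φ * Real.cos (ν * φ)) fun φ _ => by
      rw [norm_mul, Real.norm_eq_abs (Real.cos _)]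
      exact (mul_le_of_le_one_right (norm_nonneg _) (Real.abs_cos_le_one _)).trans (f.norm_coe_le_norm φ)
  rw [sub_zero, abs_of_pos Real.pi_pos] at h
  linarith

/-- ★★ **SOME BOUNDED CONTINUOUS FUNCTION HAS NON-SUMMABLE LACUNARY COEFFICIENT DIFFERENCES.**  There is
`f : ℝ →ᵇ ℝ` with `Σ_k |∫_0^π f·cos((4^{k+1}+1)·) − ∫_0^π f·cos((4^{k+1}+3)·)| = ∞`.  (Banach–Steinhaus:
were all these series summable, the functionals `ℓ_M = Σ_{k<M} d_k` would be pointwise, hence uniformly,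
bounded; but `ℓ_M(Im R_M) = (π∕2)√M` with `‖Im R_M‖ ≤ e^{1∕2}`.) NON-CONSTRUCTIVE. [folklore] -/
theorem exists_bcf_lacunaryCoeffDiff_not_summable :
    ∃ f : ℝ →ᵇ ℝ, ¬ Summable (fun k : ℕ =>
      |(∫ φ in (0 : ℝ)..π, f φ * Real.cos (((4 : ℝ) ^ (k + 1) + 1) * φ)) -
        ∫ φ in (0 : ℝ)..π, f φ * Real.cos (((4 : ℝ) ^ (k + 1) + 3) * φ)|) := by
  classical
  by_contra H
  push Not at H
  choose L hL using fun k : ℕ => exists_cosCoeffCLM ((4 : ℝ) ^ (k + 1) + 1)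
  choose L' hL' using fun k : ℕ => exists_cosCoeffCLM ((4 : ℝ) ^ (k + 1) + 3)
  set g : ℕ → (ℝ →ᵇ ℝ) →L[ℝ] ℝ := fun M => ∑ k ∈ range M, (L k - L' k) with hg
  have hg_apply : ∀ (M : ℕ) (f : ℝ →ᵇ ℝ), g M f = ∑ k ∈ range M,
      ((∫ φ in (0 : ℝ)..π, f φ * Real.cos (((4 : ℝ) ^ (k + 1) + 1) * φ)) -
        ∫ φ in (0 : ℝ)..π, f φ * Real.cos (((4 : ℝ) ^ (k + 1) + 3) * φ)) := by
    intro M f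
    simp only [hg, _root_.sum_apply, _root_.sub_apply, hL, hL']
  -- pointwise boundedness from the assumed summability
  have hpt : ∀ f : ℝ →ᵇ ℝ, ∃ C, ∀ M, ‖g M f‖ ≤ C := by
    intro f
    refine ⟨∑' k, |(∫ φ in (0 : ℝ)..π, f φ * Real.cos (((4 : ℝ) ^ (k + 1) + 1) * φ)) -
        ∫ φ in (0 : ℝ)..π, f φ * Real.cos (((4 : ℝ) ^ (k + 1) + 3) * φ)|, fun M => ?_⟩
    rw [hg_apply, Real.norm_eq_abs]
    exact (Finset.abs_sum_le_sum_abs _ _).trans ((H f).sum_le_tsum (range M) fun _ _ => abs_nonneg _)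
  obtain ⟨C', hC'⟩ := banach_steinhaus (g := g) hpt
  have hC'0 : 0 ≤ C' := (norm_nonneg _).trans (hC' 0)
  -- the Riesz product with `M` factors, `a = 1∕√M`
  set N : ℕ := ⌈C' * Real.exp (1 / 2)⌉₊ + 1 with hN
  set M : ℕ := N ^ 2 with hM
  have hN1 : (1 : ℝ) ≤ N := by rw [hN]; push_cast; linarith [Nat.le_ceil (C' * Real.exp (1 / 2))]
  have hM1 : 1 ≤ M := by rw [hM]; exact Nat.one_le_pow _ _ (by omega)
  have hsqrtM : Real.sqrt M = N := by
    rw [hM]; push_cast; exact Real.sqrt_sq (by positivity)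
  have hNgt : C' * Real.exp (1 / 2) < N := by
    rw [hN]; push_cast; linarith [Nat.le_ceil (C' * Real.exp (1 / 2))]
  set a : ℝ := (Real.sqrt M)⁻¹ with ha
  set h : ℝ →ᵇ ℝ := BoundedContinuousFunction.ofNormedAddCommGroup
    (fun φ => (∏ k ∈ range M, ((1 : ℂ) + (Complex.I * a) *
      (Real.cos (((4 : ℝ) ^ (k + 1) + 1) * φ) : ℂ))).im)
    (continuous_im_rieszProd M a) (Real.exp (1 / 2)) (fun φ => by
      rw [Real.norm_eq_abs]; exact abs_im_rieszProd_le hM1 φ) with hh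
  have hnorm : ‖h‖ ≤ Real.exp (1 / 2) :=
    BoundedContinuousFunction.norm_ofNormedAddCommGroup_le _ (Real.exp_pos _).le _
  -- the value of `ℓ_M` at the Riesz product
  have hval : g M h = Real.sqrt M * (π / 2) := by
    rw [hg_apply]
    have hterm : ∀ k ∈ range M,
        ((∫ φ in (0 : ℝ)..π, h φ * Real.cos (((4 : ℝ) ^ (k + 1) + 1) * φ)) -
          ∫ φ in (0 : ℝ)..π, h φ * Real.cos (((4 : ℝ) ^ (k + 1) + 3) * φ)) = a * (π / 2) := by
      intro k hk
      simp only [hh, BoundedContinuousFunction.coe_ofNormedAddCommGroup]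
      rw [cosCoeff_im_rieszProd_lacFreq (Finset.mem_range.1 hk) a, cosCoeff_im_rieszProd_shifted M k a,
        sub_zero]
    rw [Finset.sum_congr rfl hterm, Finset.sum_const, Finset.card_range, nsmul_eq_mul, ha]
    have hMpos : (0 : ℝ) < Real.sqrt M := Real.sqrt_pos.2 (by exact_mod_cast hM1)
    have hMs : (M : ℝ) * (Real.sqrt M)⁻¹ = Real.sqrt M := by
      rw [mul_inv_eq_iff_eq_mul₀ hMpos.ne', Real.mul_self_sqrt (Nat.cast_nonneg M)]
    rw [← mul_assoc, hMs]
  -- contradiction with the uniform bound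
  have h1 : ‖g M h‖ ≤ C' * Real.exp (1 / 2) :=
    ((g M).le_opNorm h).trans (mul_le_mul (hC' M) hnorm (norm_nonneg _) hC'0)
  rw [hval, Real.norm_eq_abs, abs_of_nonneg (by positivity), hsqrtM] at h1
  have h2 : (N : ℝ) ≤ N * (π / 2) := by
    have := Real.pi_gt_three
    nlinarith
  linarith

/-- ★★ **PLAIN-FUNCTION, NORMALISED FORM.**  There is a continuous `f : ℝ → ℝ` with `|f| ≤ 1` whose
lacunary cosine-coefficient differences `∫_0^π f·cos((4^{k+1}+1)·) − ∫_0^π f·cos((4^{k+1}+3)·)` are not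
absolutely summable.  (The interface consumed by module 96.) [folklore] -/
theorem exists_continuous_lacunaryCoeffDiff_not_summable :
    ∃ f : ℝ → ℝ, Continuous f ∧ (∀ φ, |f φ| ≤ 1) ∧ ¬ Summable (fun k : ℕ =>
      |(∫ φ in (0 : ℝ)..π, f φ * Real.cos (((4 : ℝ) ^ (k + 1) + 1) * φ)) -
        ∫ φ in (0 : ℝ)..π, f φ * Real.cos (((4 : ℝ) ^ (k + 1) + 3) * φ)|) := by
  obtain ⟨f₀, hf₀⟩ := exists_bcf_lacunaryCoeffDiff_not_summable
  set B : ℝ := ‖f₀‖ + 1 with hB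
  have hBpos : 0 < B := by rw [hB]; positivity
  refine ⟨fun φ => B⁻¹ * f₀ φ, continuous_const.mul f₀.continuous, fun φ => ?_, fun hs => hf₀ ?_⟩
  · rw [abs_mul, abs_inv, abs_of_pos hBpos, inv_mul_le_iff₀ hBpos, mul_one]
    exact ((Real.norm_eq_abs _).symm.le.trans (f₀.norm_coe_le_norm φ)).trans (by rw [hB]; linarith)
  · have hscale : ∀ k : ℕ,
        |(∫ φ in (0 : ℝ)..π, f₀ φ * Real.cos (((4 : ℝ) ^ (k + 1) + 1) * φ)) -
          ∫ φ in (0 : ℝ)..π, f₀ φ * Real.cos (((4 : ℝ) ^ (k + 1) + 3) * φ)| =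
        B * |(∫ φ in (0 : ℝ)..π, B⁻¹ * f₀ φ * Real.cos (((4 : ℝ) ^ (k + 1) + 1) * φ)) -
          ∫ φ in (0 : ℝ)..π, B⁻¹ * f₀ φ * Real.cos (((4 : ℝ) ^ (k + 1) + 3) * φ)| := by
      intro k
      simp_rw [mul_assoc, intervalIntegral.integral_const_mul]
      rw [← mul_sub, abs_mul, abs_inv, abs_of_pos hBpos, ← mul_assoc, mul_inv_cancel₀ hBpos.ne', one_mul]
    simp_rw [hscale]
    exact hs.mul_left B

end Summit.QuantumFields.YangMills.Theorems.BalabanUVNodesN19RieszProductCosineFunctionals
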